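import Summits.QuantumFields.YangMills.Theorems.BalabanUVNodesN15NeumannCubeRightEntries
import HarnessLib

/-!
# Route «BalabanUVNodes» (K3⁷), node N15 = NE2, -a lane, PROGRAMME N file N-IIo: THE TWO-GRID η-DEFECT OF THE FORWARD RIGHT ENTRY OF THE NEUMANN CUBE, CONDITIONAL ON THE TORUS LETTER OF
# `𝔇(G′∇′_ν, G∇_ν)` (dag-n15-c g13 WANT g13-1 (c)⁺: «GO CONDITIONAL on `hSrc`»)

Cell `pub-ymgap`, seat `pub-ymgap-dag-n15-a` (KNIT-BY-NAME, g22; HUMAN RULING D-0062; chair R424 venue; `bears_on: R4∕N15`); `--kind proof --supports stmt-QuantumFields-20544 --as helper`.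
Sequel of N-IIn `…NeumannCubeRightEntries` (§2: `hasMaj_comp_fshift`, `symbOp_sD_eq_neg_divAdj_comp_sT`; §3: `T⁺_μ = χ_□∘Sym∘(G∘ρ(sD_μ n))∘M_{χ_□}`) and N-IIg `…NeumannCubeDivergenceDefect`
(`hasMaj_idef_chiCube_symOp_sandwich_of`).  CONSUMER: dag-n15-c g13's FILE 49 cut edition — `hSrc` is carried there as THE displayed letter of `𝔇(R̃′, R̃)`.

WHAT.  ★★★ `hasMaj_idef_rightGrad_of_torusDefect`: GIVEN `hSrc` — the torus pair's forward right entry has a two-grid defect letter `𝔇(G′∘ρ(sD′_ν n′), G∘ρ(sD_ν n)) ≤ C_s(L^k)^{−1∕(8(d+1))}e^{−δ_s d}`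
(the (1.121)–(1.123)-shaped statement for the entry «G∇», which [B5] does not print; equivalently a source-Hölder letter for the `G∇*` kernel over one coarse step: N-IIn's header explains why no
typed (1.110)∕(1.111) letter supplies it) — THEN `𝔇(T⁺′_ν, T⁺_ν) ≤ 1_□1_□·m·(L^k)^{−1∕(8(d+1))}·e^{−δd}` for `4 ≤ L^k`, every `m_T`, `k`, `r`, corner, direction: N-IIg's images-dressed sandwich with
`h0 := hSrc` and the OUTPUT Hölder steps of `G∘∇_ν = −(G∘∇*_ν)∘S_ν` (`hasMaj_divSteps_of_ineq` behind `hasMaj_comp_fshift` — no new letter there).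
HONEST FRAMING.  CONDITIONAL bookkeeping: the displayed `hSrc` is a genuine analytic input NOT in the tree (located, not asserted); everything else is LANDED rows at `U ≡ 1` on the doubled
cube torus MODEL of [B5] §1; nothing of [B6] (2.38)–(2.40)∕[B9] asserted; N15 NOT discharged (object-bound; NE2⁺ NOT PRINTED); counts UNMOVED (typed 28∕28 · discharged 5∕27); one finite torus
pair per index — NOT continuum ∕ ℝ⁴ ∕ OS ∕ mass gap ∕ Clay.  Theorems only (0 `def`).
-/

noncomputable section

open scoped BigOperators Matrix
open Finset

namespace Summit.QuantumFields.YangMills.BalabanUVNodes.N15.TwoGrid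

open Literature.MathematicalPhysics.QuantumFieldTheory.Balaban1983to89
open Literature.MathematicalPhysics.QuantumFieldTheory.Balaban1983to89.B5Prop11Plancherel (Tor fine unitVec)
open Literature.MathematicalPhysics.QuantumFieldTheory.Balaban1983to89.B6Prop26Gluing (mulOp mulOp_apply ind ind_nonneg ind_le_one)
open Literature.MathematicalPhysics.QuantumFieldTheory.King1986.Torus (blockOf tdistT tdistT_nonneg)
open Literature.MathematicalPhysics.QuantumFieldTheory.Balaban1983to89.T4EtaRateDefect (idef)
open Literature.MathematicalPhysics.QuantumFieldTheory.Balaban1983to89.T4EtaRateCoeffDefect (pull)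
open Literature.MathematicalPhysics.QuantumFieldTheory.Balaban1983to89.B11SectG (BlockNorm HasMaj)
open Literature.MathematicalPhysics.QuantumFieldTheory.Balaban1983to89.B6UnitTorusCarrier (unitTorusGeo)
open Literature.MathematicalPhysics.QuantumFieldTheory.Balaban1983to89.B5SiteBridgeP12 (MP)
open Literature.MathematicalPhysics.QuantumFieldTheory.Balaban1983to89.B5SettingP12Real (latticeSettingP12R)
open Summit.QuantumFields.YangMills.BalabanUVNodes.N15.VectorPiece (kingPrV blkFine)

variable {d : ℕ}

/-! ## §4 The forward right entry's two-grid defect, CONDITIONAL on the torus letter of `𝔇(G′∇′_μ, G∇_μ)` (the located source-regularity input) -/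

section ForwardDefect

variable {L : ℕ} [NeZero L]

open Literature.MathematicalPhysics.QuantumFieldTheory.Balaban1983to89.B5CoverP12Lattice (Lθ Lθ_nonneg)

/-- ★★★ **(c)⁺ CONDITIONAL — THE TWO-GRID η-DEFECT OF `T⁺_μ` FROM THE TORUS LETTER OF THE FORWARD RIGHT ENTRY**: IF the torus pair's forward right entry has a two-grid defect letter
`𝔇(G′∘ρ(sD′_ν n′), G∘ρ(sD_ν n)) ≤ C_s·(L^k)^{−1∕(8(d+1))}·e^{−δ_s d}` (`hSrc`, DISPLAYED: the (1.121)–(1.123)-shaped statement for the entry «G∇» that [B5] does not print — equivalently a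
source-Hölder letter for the `G∇*` kernel over one coarse step; dag-n15-c g13 carries it as the one displayed letter of `𝔇(R̃′, R̃)`), THEN `𝔇(T⁺′_ν, T⁺_ν) ≤ 1_□1_□·m·(L^k)^{−1∕(8(d+1))}·e^{−δd}`
for `4 ≤ L^k` — N-IIg's images-dressed sandwich `hasMaj_idef_chiCube_symOp_sandwich_of` with `h0 := hSrc` and the OUTPUT Hölder steps of `G∘∇_ν = −(G∘∇*_ν)∘S_ν` (`hasMaj_divSteps_of_ineq`
behind ★★ `hasMaj_comp_fshift`; these need no new letter). [cite: Balaban1985BackgroundPropagators, Thm 3.14 pp.426–427, (3.42) p.397 (shape); Balaban1984PropagatorsI, (1.111) p.36,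
(1.121)–(1.123) p.37; King1986, Prop. 3.9 p.665 (Hölder-rate shape); Balaban1984PropagatorsII, (2.133) p.247, (2.37) p.229] -/
theorem hasMaj_idef_rightGrad_of_torusDefect (hLodd : Odd L) (hL2 : 2 ≤ L) {a : ℝ} (ha : 0 < a) {δs Cs : ℝ} (hδs : 0 < δs) (hCs : 0 ≤ Cs)
    (hSrc : ∀ (mT k r : ℕ) (_hk : 1 ≤ k) (hL : Odd L ∧ 1 < L) (ν : Fin (d + 1)),
      HasMaj (BlockNorm.ofBlocks (unitTorusGeo L k (MP (paramsOf d L mT k hL))) (blkFine L k (MP (paramsOf d L mT k hL))))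
        (BlockNorm.ofBlocks (unitTorusGeo L k (MP (paramsOf d L mT k hL)))
          (fun z : Tor (fine (L ^ r * L ^ k) (MP (paramsOf d L mT k hL))) × Fin (d + 1) => blockOf (L ^ r * L ^ k) (MP (paramsOf d L mT k hL)) z.1))
        (idef (pull (kingPrV L k r (MP (paramsOf d L mT k hL)))) (pull (kingPrV L k r (MP (paramsOf d L mT k hL))))
          (gOp (MP (paramsOf d L mT k hL)) (L ^ r * L ^ k) a ∘ₗ
            symbOp (MP (paramsOf d L mT k hL)) (L ^ r * L ^ k) (sD (MP (paramsOf d L mT k hL)) (L ^ r * L ^ k) ν ((L ^ r * L ^ k : ℕ) : ℝ)))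
          (gOp (MP (paramsOf d L mT k hL)) (L ^ k) a ∘ₗ symbOp (MP (paramsOf d L mT k hL)) (L ^ k) (sD (MP (paramsOf d L mT k hL)) (L ^ k) ν ((L ^ k : ℕ) : ℝ))))
        (fun y y' => Cs * ((L ^ k : ℕ) : ℝ) ^ (-(1 / (8 * ((d : ℝ) + 1)))) * Real.exp (-(δs * tdistT (MP (paramsOf d L mT k hL)) y y')))) :
    ∃ δ m : ℝ, 0 < δ ∧ 0 < m ∧ ∀ (mT k r : ℕ) (hk : 1 ≤ k) (hn4 : 4 ≤ L ^ k) (hL : Odd L ∧ 1 < L) (c : Tor (MP (paramsOf d L mT k hL))) (ν : Fin (d + 1)),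
      HasMaj (BlockNorm.ofBlocks (unitTorusGeo L k (MP (paramsOf d L mT k hL))) (blkFine L k (MP (paramsOf d L mT k hL))))
        (BlockNorm.ofBlocks (unitTorusGeo L k (MP (paramsOf d L mT k hL)))
          (fun i : Tor (fine (L ^ r * L ^ k) (MP (paramsOf d L mT k hL))) × Fin (d + 1) => blockOf (L ^ r * L ^ k) (MP (paramsOf d L mT k hL)) i.1))
        (idef (pull (kingPrV L k r (MP (paramsOf d L mT k hL)))) (pull (kingPrV L k r (MP (paramsOf d L mT k hL))))
          (mulOp (chiCube (MP (paramsOf d L mT k hL)) (L ^ r * L ^ k) c (L ^ mT)) ∘ₗ symOp (MP (paramsOf d L mT k hL)) (L ^ r * L ^ k) c ∘ₗ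
            (gOp (MP (paramsOf d L mT k hL)) (L ^ r * L ^ k) a ∘ₗ
              symbOp (MP (paramsOf d L mT k hL)) (L ^ r * L ^ k) (sD (MP (paramsOf d L mT k hL)) (L ^ r * L ^ k) ν ((L ^ r * L ^ k : ℕ) : ℝ))) ∘ₗ
            mulOp (chiCube (MP (paramsOf d L mT k hL)) (L ^ r * L ^ k) c (L ^ mT)))
          (mulOp (chiCube (MP (paramsOf d L mT k hL)) (L ^ k) c (L ^ mT)) ∘ₗ symOp (MP (paramsOf d L mT k hL)) (L ^ k) c ∘ₗ
            (gOp (MP (paramsOf d L mT k hL)) (L ^ k) a ∘ₗ symbOp (MP (paramsOf d L mT k hL)) (L ^ k) (sD (MP (paramsOf d L mT k hL)) (L ^ k) ν ((L ^ k : ℕ) : ℝ))) ∘ₗ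
            mulOp (chiCube (MP (paramsOf d L mT k hL)) (L ^ k) c (L ^ mT))))
        (fun y y' => ind ((cubeBlocks (MP (paramsOf d L mT k hL)) c (L ^ mT) : Finset _) : Set _) y *
          ind ((cubeBlocks (MP (paramsOf d L mT k hL)) c (L ^ mT) : Finset _) : Set _) y' *
          (m * ((L ^ k : ℕ) : ℝ) ^ (-(1 / (8 * ((d : ℝ) + 1)))) * Real.exp (-(δ * tdistT (MP (paramsOf d L mT k hL)) y y')))) := by
  have hL : Odd L ∧ 1 < L := ⟨hLodd, by omega⟩
  obtain ⟨δ₀, C, Cα, Cε, Cαε, hδ₀, hC, H3⟩ := ineq110_114_pair (d := d) hL ha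
  have hLθ0 : 0 ≤ Lθ (d + 1) := Lθ_nonneg _
  obtain ⟨δ, hδdef⟩ : ∃ δ : ℝ, δ = min δs δ₀ := ⟨_, rfl⟩
  have hδpos : 0 < δ := hδdef ▸ lt_min hδs hδ₀
  have hδsle : δ ≤ δs := hδdef ▸ min_le_left _ _
  have hδ₀le : δ ≤ δ₀ := hδdef ▸ min_le_right _ _
  obtain ⟨CH, hCH⟩ : ∃ CH : ℝ, CH = 2 * (|Cα (1 / 2)| * (Lθ (d + 1) + 1) * Real.exp δ₀ * Real.exp δ₀) := ⟨_, rfl⟩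
  have hCH0 : 0 ≤ CH := by rw [hCH]; positivity
  refine ⟨δ, 2 ^ (d + 1) * Real.exp δ * (Cs + (d + 1) * CH) + 1, hδpos, by positivity, fun mT k r hk hn4 hL' c ν => ?_⟩
  have hM : ∀ μ, MP (paramsOf d L mT k hL') μ = 2 * L ^ mT := fun μ => rfl
  have hM2 : ∀ μ, 2 ≤ MP (paramsOf d L mT k hL') μ := fun μ => by
    rw [hM μ]; exact Nat.le_mul_of_pos_right 2 (pow_pos (by omega) _)
  have hn1 : 1 ≤ L ^ k := Nat.one_le_pow _ _ (by omega)
  have hnr1 : (1 : ℝ) ≤ ((L ^ k : ℕ) : ℝ) := by exact_mod_cast hn1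
  have hnr0 : (0 : ℝ) < ((L ^ k : ℕ) : ℝ) := by linarith
  have hρ0 : 0 ≤ ((L ^ k : ℕ) : ℝ) ^ (-(1 / (8 * ((d : ℝ) + 1)))) := Real.rpow_nonneg hnr0.le _
  -- the displayed torus defect at this index, decay weakened to `δ`
  have h0 := hasMaj_rate_mono (A := Cs * ((L ^ k : ℕ) : ℝ) ^ (-(1 / (8 * ((d : ℝ) + 1))))) (mul_nonneg hCs hρ0) hδsle (hSrc mT k r hk hL' ν)
  -- one OUTPUT step of `G∇_ν = −(G∇*_ν)∘S_ν`: the Hölder letter at `α = ½`, `j = 1`, then the source shift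
  have hst0 : 0 ≤ |Cα (1 / 2)| * (Lθ (d + 1) + 1) * Real.exp δ₀ * (((1 : ℕ) : ℝ) / ((L ^ k : ℕ) : ℝ)) ^ (1 / 2 : ℝ) :=
    mul_nonneg (by positivity) (Real.rpow_nonneg (by positivity) _)
  have hstep0 : 0 ≤ 2 * (|Cα (1 / 2)| * (Lθ (d + 1) + 1) * Real.exp δ₀ * (((1 : ℕ) : ℝ) / ((L ^ k : ℕ) : ℝ)) ^ (1 / 2 : ℝ) * Real.exp δ₀) := by positivity
  have h1 : ∀ μ : Fin (d + 1), HasMaj (BlockNorm.ofBlocks (unitTorusGeo L k (MP (paramsOf d L mT k hL'))) (blkFine L k (MP (paramsOf d L mT k hL'))))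
      (BlockNorm.ofBlocks (unitTorusGeo L k (MP (paramsOf d L mT k hL'))) (blkFine L k (MP (paramsOf d L mT k hL'))))
      (symbOp (MP (paramsOf d L mT k hL')) (L ^ k) (sT (MP (paramsOf d L mT k hL')) (L ^ k) μ - 1) ∘ₗ
        (gOp (MP (paramsOf d L mT k hL')) (L ^ k) a ∘ₗ symbOp (MP (paramsOf d L mT k hL')) (L ^ k) (sD (MP (paramsOf d L mT k hL')) (L ^ k) ν ((L ^ k : ℕ) : ℝ))))
      (fun y y' => 2 * (|Cα (1 / 2)| * (Lθ (d + 1) + 1) * Real.exp δ₀ * (((1 : ℕ) : ℝ) / ((L ^ k : ℕ) : ℝ)) ^ (1 / 2 : ℝ) * Real.exp δ₀) *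
        Real.exp (-(δ * tdistT (MP (paramsOf d L mT k hL')) y y'))) := by
    intro μ
    have h := hasMaj_divSteps_of_ineq (L := L) (k := k) (MP (paramsOf d L mT k hL')) (L ^ k) a hM2 (j := 1) (by omega) (H3 mT k r hk).1 hδ₀.le
      (α := 1 / 2) (by norm_num) (by norm_num) μ ν
    rw [pow_one] at h
    have h' := (hasMaj_comp_fshift hst0 hδ₀.le ν h).neg
    have e : -((symbOp (MP (paramsOf d L mT k hL')) (L ^ k) (sT (MP (paramsOf d L mT k hL')) (L ^ k) μ - 1) ∘ₗ gOp (MP (paramsOf d L mT k hL')) (L ^ k) a ∘ₗ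
          symbOp (MP (paramsOf d L mT k hL')) (L ^ k) (((L ^ k : ℕ) : ℝ) • (sTinv (MP (paramsOf d L mT k hL')) (L ^ k) ν - 1))) ∘ₗ
          symbOp (MP (paramsOf d L mT k hL')) (L ^ k) (sT (MP (paramsOf d L mT k hL')) (L ^ k) ν)) =
        symbOp (MP (paramsOf d L mT k hL')) (L ^ k) (sT (MP (paramsOf d L mT k hL')) (L ^ k) μ - 1) ∘ₗ
          (gOp (MP (paramsOf d L mT k hL')) (L ^ k) a ∘ₗ symbOp (MP (paramsOf d L mT k hL')) (L ^ k) (sD (MP (paramsOf d L mT k hL')) (L ^ k) ν ((L ^ k : ℕ) : ℝ))) := by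
      rw [symbOp_sD_eq_neg_divAdj_comp_sT, LinearMap.comp_neg, LinearMap.comp_neg]
      simp only [LinearMap.comp_assoc]
    exact hasMaj_rate_mono hstep0 hδ₀le (h'.congr fun f => by rw [← e])
  have hmain := hasMaj_idef_chiCube_symOp_sandwich_of (r := r) (c := c) hM (mul_nonneg hCs hρ0) hstep0 hδpos.le h0 h1
  refine hmain.mono fun y y' => ?_
  -- `(1∕L^k)^{½} ≤ (L^k)^{−1∕(8(d+1))}`
  have hd0 : (0 : ℝ) ≤ (d : ℝ) := Nat.cast_nonneg d
  have hexp : (((1 : ℕ) : ℝ) / ((L ^ k : ℕ) : ℝ)) ^ (1 / 2 : ℝ) ≤ ((L ^ k : ℕ) : ℝ) ^ (-(1 / (8 * ((d : ℝ) + 1)))) := by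
    rw [Nat.cast_one, one_div, Real.inv_rpow hnr0.le, ← Real.rpow_neg hnr0.le]
    refine Real.rpow_le_rpow_of_exponent_le hnr1 ?_
    rw [neg_le_neg_iff, one_div, one_div]
    exact inv_anti₀ (by norm_num) (by nlinarith)
  have hstep : 2 * (|Cα (1 / 2)| * (Lθ (d + 1) + 1) * Real.exp δ₀ * (((1 : ℕ) : ℝ) / ((L ^ k : ℕ) : ℝ)) ^ (1 / 2 : ℝ) * Real.exp δ₀) ≤
      CH * ((L ^ k : ℕ) : ℝ) ^ (-(1 / (8 * ((d : ℝ) + 1)))) := by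
    rw [hCH]
    have := mul_le_mul_of_nonneg_left hexp (by positivity : 0 ≤ 2 * (|Cα (1 / 2)| * (Lθ (d + 1) + 1) * Real.exp δ₀ * Real.exp δ₀))
    calc 2 * (|Cα (1 / 2)| * (Lθ (d + 1) + 1) * Real.exp δ₀ * (((1 : ℕ) : ℝ) / ((L ^ k : ℕ) : ℝ)) ^ (1 / 2 : ℝ) * Real.exp δ₀)
        = 2 * (|Cα (1 / 2)| * (Lθ (d + 1) + 1) * Real.exp δ₀ * Real.exp δ₀) * (((1 : ℕ) : ℝ) / ((L ^ k : ℕ) : ℝ)) ^ (1 / 2 : ℝ) := by ring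
      _ ≤ 2 * (|Cα (1 / 2)| * (Lθ (d + 1) + 1) * Real.exp δ₀ * Real.exp δ₀) * ((L ^ k : ℕ) : ℝ) ^ (-(1 / (8 * ((d : ℝ) + 1)))) := this
  have h2d : (0 : ℝ) ≤ 2 ^ (d + 1) * Real.exp δ := by positivity
  have hd1 : (0 : ℝ) ≤ (d : ℝ) + 1 := by positivity
  have hcoef : 2 ^ (d + 1) * Real.exp δ * (Cs * ((L ^ k : ℕ) : ℝ) ^ (-(1 / (8 * ((d : ℝ) + 1)))) +
        (d + 1) * (2 * (|Cα (1 / 2)| * (Lθ (d + 1) + 1) * Real.exp δ₀ * (((1 : ℕ) : ℝ) / ((L ^ k : ℕ) : ℝ)) ^ (1 / 2 : ℝ) * Real.exp δ₀))) ≤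
      2 ^ (d + 1) * Real.exp δ * (Cs + (d + 1) * CH) * ((L ^ k : ℕ) : ℝ) ^ (-(1 / (8 * ((d : ℝ) + 1)))) :=
    calc 2 ^ (d + 1) * Real.exp δ * (Cs * ((L ^ k : ℕ) : ℝ) ^ (-(1 / (8 * ((d : ℝ) + 1)))) +
          (d + 1) * (2 * (|Cα (1 / 2)| * (Lθ (d + 1) + 1) * Real.exp δ₀ * (((1 : ℕ) : ℝ) / ((L ^ k : ℕ) : ℝ)) ^ (1 / 2 : ℝ) * Real.exp δ₀)))
        ≤ 2 ^ (d + 1) * Real.exp δ * (Cs * ((L ^ k : ℕ) : ℝ) ^ (-(1 / (8 * ((d : ℝ) + 1)))) + (d + 1) * (CH * ((L ^ k : ℕ) : ℝ) ^ (-(1 / (8 * ((d : ℝ) + 1)))))) :=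
          mul_le_mul_of_nonneg_left (add_le_add_right (mul_le_mul_of_nonneg_left hstep hd1) _) h2d
      _ = 2 ^ (d + 1) * Real.exp δ * (Cs + (d + 1) * CH) * ((L ^ k : ℕ) : ℝ) ^ (-(1 / (8 * ((d : ℝ) + 1)))) := by ring
  have hcoef' : 2 ^ (d + 1) * Real.exp δ * (Cs * ((L ^ k : ℕ) : ℝ) ^ (-(1 / (8 * ((d : ℝ) + 1)))) +
        (d + 1) * (2 * (|Cα (1 / 2)| * (Lθ (d + 1) + 1) * Real.exp δ₀ * (((1 : ℕ) : ℝ) / ((L ^ k : ℕ) : ℝ)) ^ (1 / 2 : ℝ) * Real.exp δ₀))) ≤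
      (2 ^ (d + 1) * Real.exp δ * (Cs + (d + 1) * CH) + 1) * ((L ^ k : ℕ) : ℝ) ^ (-(1 / (8 * ((d : ℝ) + 1)))) :=
    hcoef.trans (by nlinarith [hρ0])
  exact mul_le_mul_of_nonneg_left (mul_le_mul_of_nonneg_right hcoef' (Real.exp_nonneg _)) (mul_nonneg (ind_nonneg _ _) (ind_nonneg _ _))

end ForwardDefect

end Summit.QuantumFields.YangMills.BalabanUVNodes.N15.TwoGrid

end
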